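import Literature.MathematicalPhysics.QuantumFieldTheory.Balaban1983to89.B8Prop6CubeMemberNormsAt

/-!
# `Balaban1983to89.B8Prop6CubeMemberNormsFlat` — [Balaban1985RegularSpaces] PROPOSITION 6 (p. 99), (1.136)₂–₄ AT THE CONCRETE CUBE MEMBER
# FROM THE (1.59) BODY **AT BACKGROUND 1 ONLY** — the flat currency of the Prop.-3 input («the configuration is equal to 1», p. 99)

statement-level skeleton of published theorems with citation tags; proofs where landed; nothing here is a claim about the
Yang–Mills mass gap

T. Bałaban, *Spaces of regular gauge field configurations on a lattice and gauge fixing conditions*, Commun. Math. Phys. **99**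
(1985) 75–102 `[Balaban1985RegularSpaces]` ("B8"), Proposition 3 p. 87, Proposition 6 (1.136) p. 99, (1.59)–(1.61) p. 86.
PDF held: `paper:balaban1985-cmp99-regular-spaces-gauge-fixing` (journal page = PDF page + 74).

CITATION HEADER (lean-in-tree rule).  Cell `pub-ymgap` (YM Track A, HUMAN RULING D-0062), DAG node N05 = [B8], seat `pub-ymgap-dag-n05-e`
(g2; director-ym R141 (C), FAN-OUT §N05 row s3b successor — THE FLAT CURRENCY for Proposition 6).  This seat's g0 module
`B8Prop6CubeMemberNormsAt` derives Proposition 6's norm members (1.136)₂–₄ (+ Hölder, + (1.37)) from Proposition 3 at the cube member with the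
[4]-Thm-3.3 input as the member-level SOCKET `SockB9P3 … η k {□_j} (cubeLamS …) (cubeLamB …)` — (1.59) for `G(U₀)` at EVERY background
`U₀ ∈ 𝔄_k({□_j}, ·)`.  Proposition 6 reads Proposition 3 at background `1` only (p. 99: «The functions and derivatives above are defined without any
external gauge field configuration (or the configuration is equal to 1)»).  THIS FILE is the same pair of theorems with the socket replaced by
its BODY AT `U₀ = 1`: **`norms136_cubeMember_flat`**, **`norms136_cubeMember_printed_flat`** — the displayed (1.59) hypothesis is a statement
about the FLAT multi-level operators on the finite cube family (the currency of `B8Ineq159MultiLevelTorus` ∕ the [B6] box carriers).  Proofs =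
the g0 proofs VERBATIM with the one socket application replaced by the body.

HONEST SCOPE.  The flat (1.59) body is NOT discharged here ([4] Thm 3.3 for `G(1)` on the nested Dirichlet cubes with the Λ-tower averaging —
a multi-level random-walk estimate; the `ℤᵈ`-cube dictionary to the tree's torus ∕ box lineage is not in the tree); HONEST SCOPE of
`B8Prop6CubeMemberNormsAt` ∕ `B8Prop6CubeMemberNorms` applies verbatim (norm form `≤`, `B₁ = 5dLB₀`, `C₂ ≥ 2097152(d+1)²`).  Count-neutral; N05
NOT discharged; one finite `T⁴` programme at fixed `ε`, Bałaban as printed; nothing continuum ∕ ℝ⁴ ∕ OS ∕ mass-gap ∕ Clay.  No `sorry`, no `def`,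
no `instance`, no `notation`.  Unit `pub-ymgap-dag-n05-e` (g2), 2026-08-26.
-/

noncomputable section

open NormedSpace

namespace Literature.MathematicalPhysics.QuantumFieldTheory.Balaban1983to89.B8Prop6CubeMemberNormsFlat

open MatrixLog B7Prop1Explicit B7Prop2Explicit B7Prop1Local B7Eq92Concrete
open B7Prop3Flat (c3 c3_pos)
open B7Prop4GeneralLevels (logCovIter linCovIter)
open B8Ineq130 (gaugeAct_one)
open B8Ineq132 (covDerivFwd InAk inAk_gaugeAct_iff)
open B8Ineq133 (cutFixed)
open B8Lemma1NonAbelian (mulCfg)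
open B8Eq115GaugeFixing (gaugeAct_mul gaugeAct_mem_of)
open B8Eq146AExpansion (iEta expCfg plaqCovDeriv)
open B8Eq143PlaqExpansion (pdiv)
open B8Eq184Proof (cfgExp)
open B8Eq140Level (SideTouches)
open B8Eq119TwistedAxial (InAx Restr129)
open B8Eq155JBound (Jcur wsup)
open B8ScaledSupNorm (bondNorm msup weight Bdd)
open B8Eq138LandauZd (IsLandau138W logCfg covLap)
open B8Eq131Cubes (tcube tLo tHi ctr)
open B8Eq131CubesAdmissible (cubeFam)
open B8CubeMemberZd (cubeLamS cubeLamB hbox_cubeLamB)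
open B8Prop6CubeMember (thm4_hypotheses_one_cutFixed regime_of_printed_smallness)
open B8Prop6OfThm4 (const_136)
open B8Prop3GaugeFixedKLevel (inAk_congr_of_sideTouches expCfg_iEta_eq_cfgExp)
open B8LeafModelZd3 (mlogCfg mlogCfg_spec mlogCfg_of_sideTouches mlogCfg_of_not SockB9P3 prop3_windows)
open B9Eq340HolderZd (hquot AdmPair)
open B8Prop6CubeMemberNorms (c137_cubeMember ineq161_of_small)

-- `Site` alone could resolve to the torus sites of `Setup.lean`; re-export the `ℤ^d` sites of `B7Prop1Explicit`.
export B7Prop1Explicit (Site)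

variable {d : ℕ}
open B8Prop6CubeMemberNormsAt (windows136_of_small)

variable {𝔸 : Type} [CStarAlgebra 𝔸] [Nontrivial 𝔸]

/-! ## §1 Proposition 3 at the member from the flat (1.59) body -/

/-- **PROPOSITION 3 (p. 87) AT THE CONCRETE CUBE MEMBER, BACKGROUND `1`, FROM THE FLAT (1.59) BODY: THE NORM MEMBERS OF (1.136)** —
`B8Prop6CubeMemberNormsAt.norms136_cubeMember_at` (this seat, g0) with its member-level b9 SOCKET (`SockB9P3 … η k {□_j} …`, quantified over EVERY
background `U₀ ∈ 𝔄_k({□_j}, ·)`) replaced by the socket's BODY AT BACKGROUND `1` ONLY — (1.59)'s five lines for `G(1)` on the cube family, for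
the fields `W` in the Landau gauge of record w.r.t. `1` and their masked Hermitian exponents `A′` (a statement about the FLAT operators `Jcur η 1`,
`linCovIter L 1`, `covDerivFwd η 1`, `covLap η 1`, `hquot … 1`).  Print's Proposition 6 applies Proposition 3 «without any external gauge field
configuration (or the configuration is equal to 1)» (p. 99).  Same threshold, same conclusion, same proof (one application of the body).
[cite: Balaban1985RegularSpaces, Prop. 3 p.87, Prop. 6 (1.136) p.99 («the configuration is equal to 1»), (1.40)–(1.42) p.83, (1.59)–(1.61) p.86] -/
theorem norms136_cubeMember_flat (hd2 : 2 ≤ d) {L : ℕ} (hL : 2 ≤ L) {B₀ B₀β C₂ cB9 : ℝ} (hB₀ : 0 < B₀) (hB₀β : 0 ≤ B₀β)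
    (hC₂ : 2097152 * ((d : ℝ) + 1) ^ 2 ≤ C₂) (hcB9 : 0 < cB9) (β : ℝ) (len : Site d → ℝ) :
    ∃ c : ℝ, 0 < c ∧ ∀ (η : ℝ), 0 < η → ∀ (k : ℕ), 1 ≤ k → ∀ (a : Site d) (M ρ : ℕ), L ≤ ρ → ρ ≤ M → 11 * (d : ℝ) < M →
      (∀ α₀' α₂ : ℝ, 0 < α₀' → α₀' ≤ cB9 → 0 < α₂ → α₂ ≤ cB9 →
        ∀ (W : Site d → Fin d → 𝔸ˣ), (∀ x κ, W x κ ∈ unitaryUnits 𝔸) →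
        InAk L k η α₀' (cubeFam false L a M ρ k) (1 : Site d → Fin d → 𝔸ˣ) → InAk L k η α₀' (cubeFam false L a M ρ k) (mulCfg W (1 : Site d → Fin d → 𝔸ˣ)) →
        IsLandau138W L k η (cubeFam false L a M ρ k 0) (cubeLamS L a M ρ k k) (1 : Site d → Fin d → 𝔸ˣ) W →
        ∀ A' : Site d → Fin d → 𝔸, (∀ y τ, IsSelfAdjoint (A' y τ)) →
        (∀ j, j ≤ k → ∀ (y : Site d) (τ : Fin d), SideTouches (cubeFam false L a M ρ k j) y τ →
          W y τ = cfgExp η A' y τ ∧ ‖A' y τ‖ ≤ α₂ * ((L : ℝ) ^ j * η)⁻¹) →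
        (∀ (y : Site d) (τ : Fin d), (∀ j, j ≤ k → ¬ SideTouches (cubeFam false L a M ρ k j) y τ) → A' y τ = 0) →
        msup L k η (-(1 : ℝ)) (fun j (b : Site d × Fin d) => SideTouches (cubeFam false L a M ρ k j) b.1 b.2) (fun b => A' b.1 b.2)
            ≤ B₀ * (bondNorm L k η (-(3 : ℝ)) (cubeFam false L a M ρ k) (fun x μ => Jcur η (1 : Site d → Fin d → 𝔸ˣ) A' μ x)
              + wsup 1 (fun p : {p : ℕ × (Site d × Fin d) // p.1 ≤ k ∧ p.2 ∈ cubeLamB L a M ρ k k p.1} =>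
                  linCovIter L (1 : Site d → Fin d → 𝔸ˣ) (iEta η A') p.1.1 p.1.2.1 p.1.2.2)) ∧
          msup L k η (-(2 : ℝ)) (fun j (t : Fin d × Fin d × Site d) => SideTouches (cubeFam false L a M ρ k j) t.2.2 t.2.1)
              (fun t => covDerivFwd η (1 : Site d → Fin d → 𝔸ˣ) t.1 (fun z => A' z t.2.1) t.2.2)
            ≤ B₀ * (bondNorm L k η (-(3 : ℝ)) (cubeFam false L a M ρ k) (fun x μ => Jcur η (1 : Site d → Fin d → 𝔸ˣ) A' μ x)
              + wsup 1 (fun p : {p : ℕ × (Site d × Fin d) // p.1 ≤ k ∧ p.2 ∈ cubeLamB L a M ρ k k p.1} =>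
                  linCovIter L (1 : Site d → Fin d → 𝔸ˣ) (iEta η A') p.1.1 p.1.2.1 p.1.2.2)) ∧
          bondNorm L k η (-(3 : ℝ)) (cubeFam false L a M ρ k) (fun x μ => pdiv η (1 : Site d → Fin d → 𝔸ˣ) (plaqCovDeriv η (1 : Site d → Fin d → 𝔸ˣ) A') μ x)
            ≤ B₀ * (bondNorm L k η (-(3 : ℝ)) (cubeFam false L a M ρ k) (fun x μ => Jcur η (1 : Site d → Fin d → 𝔸ˣ) A' μ x)
              + wsup 1 (fun p : {p : ℕ × (Site d × Fin d) // p.1 ≤ k ∧ p.2 ∈ cubeLamB L a M ρ k k p.1} =>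
                  linCovIter L (1 : Site d → Fin d → 𝔸ˣ) (iEta η A') p.1.1 p.1.2.1 p.1.2.2)) ∧
          bondNorm L k η (-(3 : ℝ)) (cubeFam false L a M ρ k) (fun x μ => covLap η (1 : Site d → Fin d → 𝔸ˣ) (fun z => A' z μ) x)
            ≤ B₀ * (bondNorm L k η (-(3 : ℝ)) (cubeFam false L a M ρ k) (fun x μ => Jcur η (1 : Site d → Fin d → 𝔸ˣ) A' μ x)
              + wsup 1 (fun p : {p : ℕ × (Site d × Fin d) // p.1 ≤ k ∧ p.2 ∈ cubeLamB L a M ρ k k p.1} =>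
                  linCovIter L (1 : Site d → Fin d → 𝔸ˣ) (iEta η A') p.1.1 p.1.2.1 p.1.2.2)) ∧
          msup L k η (-(2 + β)) (fun j (q : Fin d × Fin d × (Site d × Site d)) => q.2.2 ∈ AdmPair η len ∧ q.2.2.1 ∈ cubeFam false L a M ρ k j)
              (fun q => hquot η β len (1 : Site d → Fin d → 𝔸ˣ) (covDerivFwd η (1 : Site d → Fin d → 𝔸ˣ) q.1 (fun z => A' z q.2.1)) q.2.2)
            ≤ B₀β * (bondNorm L k η (-(3 : ℝ)) (cubeFam false L a M ρ k) (fun x μ => Jcur η (1 : Site d → Fin d → 𝔸ˣ) A' μ x)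
              + wsup 1 (fun p : {p : ℕ × (Site d × Fin d) // p.1 ≤ k ∧ p.2 ∈ cubeLamB L a M ρ k k p.1} =>
                  linCovIter L (1 : Site d → Fin d → 𝔸ˣ) (iEta η A') p.1.1 p.1.2.1 p.1.2.2))) →
      ∀ (U₀ : Site d → Fin d → 𝔸ˣ), (∀ x κ, U₀ x κ ∈ unitaryUnits 𝔸) → ∀ (α₀ : ℝ), 0 < α₀ →
      C0 d * (α₀ * (L : ℝ) ^ 2) ≤ 1 / 3 → 2 * (α₀ * (L : ℝ) ^ 2) ≤ c2' d L →
      ∀ (Ω : ℕ → Set (Site d)), InAk L k η α₀ Ω U₀ → tcube L a M ρ k ⊆ Ω (k - 1) →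
      11 * (d : ℝ) ^ 2 * (L : ℝ) ^ 2 * α₀ + ((M : ℝ) + 4 * ρ) * d * (L : ℝ) ^ 2 * α₀ ≤ 1 / 6 →
      (L : ℝ) ^ 3 * α₀ ≤ c → 5 * (d : ℝ) * L * B₀ * ((L : ℝ) ^ 3 * α₀ + 6 * d * (L : ℝ) ^ 2 * M * α₀) ≤ c →
      2 * (5 * (d : ℝ) * L * B₀ * ((L : ℝ) ^ 3 * α₀ + 6 * d * (L : ℝ) ^ 2 * M * α₀)) ^ 2
        + 20 * d * ((L : ℝ) ^ 3 * α₀) * (5 * (d : ℝ) * L * B₀ * ((L : ℝ) ^ 3 * α₀ + 6 * d * (L : ℝ) ^ 2 * M * α₀))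
        + 2 * C₂ * (5 * (d : ℝ) * L * B₀ * ((L : ℝ) ^ 3 * α₀ + 6 * d * (L : ℝ) ^ 2 * M * α₀)) ^ 2
        ≤ (L : ℝ) ^ 3 * α₀ + 6 * d * (L : ℝ) ^ 2 * M * α₀ →
      (d : ℝ) * L * (6 * d * (L : ℝ) ^ 2 * M * α₀) ≤ 1 / 8 →
      ∀ (u : Site d → 𝔸ˣ), (∀ x, u x ∈ unitaryUnits 𝔸) →
      Restr129 L k (cubeLamS L a M ρ k k) (1 : Site d → Fin d → 𝔸ˣ) u →
      IsLandau138W L k η (cubeFam false L a M ρ k 0) (cubeLamS L a M ρ k k) (1 : Site d → Fin d → 𝔸ˣ)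
        (gaugeAct u⁻¹ (cutFixed L (tLo a ρ) (tHi a M ρ) U₀ k (ctr a M))) →
      (∀ j, j ≤ k → ∀ b ∈ {b : Site d × Fin d | SideTouches (cubeFam false L a M ρ k j) b.1 b.2},
        gaugeAct u⁻¹ (cutFixed L (tLo a ρ) (tHi a M ρ) U₀ k (ctr a M)) b.1 b.2 =
            cfgExp η (logCfg η (gaugeAct u⁻¹ (cutFixed L (tLo a ρ) (tHi a M ρ) U₀ k (ctr a M)))) b.1 b.2 ∧
          IsSelfAdjoint (logCfg η (gaugeAct u⁻¹ (cutFixed L (tLo a ρ) (tHi a M ρ) U₀ k (ctr a M))) b.1 b.2) ∧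
          ‖logCfg η (gaugeAct u⁻¹ (cutFixed L (tLo a ρ) (tHi a M ρ) U₀ k (ctr a M))) b.1 b.2‖ ≤
            (5 * (d : ℝ) * L * B₀ * ((L : ℝ) ^ 3 * α₀ + 6 * d * (L : ℝ) ^ 2 * M * α₀)) * ((L : ℝ) ^ j * η)⁻¹) →
      msup L k η (-(2 : ℝ)) (fun j (t : Fin d × Fin d × Site d) => SideTouches (cubeFam false L a M ρ k j) t.2.2 t.2.1)
          (fun t => covDerivFwd η (1 : Site d → Fin d → 𝔸ˣ) t.1 (fun z => mlogCfg k η (cubeFam false L a M ρ k)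
            (gaugeAct u⁻¹ (cutFixed L (tLo a ρ) (tHi a M ρ) U₀ k (ctr a M))) z t.2.1) t.2.2)
        ≤ 5 * (d : ℝ) * L * B₀ * ((L : ℝ) ^ 3 * α₀ + 6 * d * (L : ℝ) ^ 2 * M * α₀) ∧
      msup L k η (-(2 + β)) (fun j (q : Fin d × Fin d × (Site d × Site d)) => q.2.2 ∈ AdmPair η len ∧ q.2.2.1 ∈ cubeFam false L a M ρ k j)
          (fun q => hquot η β len (1 : Site d → Fin d → 𝔸ˣ) (covDerivFwd η (1 : Site d → Fin d → 𝔸ˣ) q.1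
            (fun z => mlogCfg k η (cubeFam false L a M ρ k) (gaugeAct u⁻¹ (cutFixed L (tLo a ρ) (tHi a M ρ) U₀ k (ctr a M))) z q.2.1))
            q.2.2)
        ≤ 5 * (d : ℝ) * L * B₀β * ((L : ℝ) ^ 3 * α₀ + 6 * d * (L : ℝ) ^ 2 * M * α₀) ∧
      bondNorm L k η (-(3 : ℝ)) (cubeFam false L a M ρ k) (fun x μ => pdiv η (1 : Site d → Fin d → 𝔸ˣ)
          (plaqCovDeriv η (1 : Site d → Fin d → 𝔸ˣ) (mlogCfg k η (cubeFam false L a M ρ k)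
            (gaugeAct u⁻¹ (cutFixed L (tLo a ρ) (tHi a M ρ) U₀ k (ctr a M))))) μ x)
        ≤ 5 * (d : ℝ) * L * B₀ * ((L : ℝ) ^ 3 * α₀ + 6 * d * (L : ℝ) ^ 2 * M * α₀) ∧
      bondNorm L k η (-(3 : ℝ)) (cubeFam false L a M ρ k) (fun x μ => covLap η (1 : Site d → Fin d → 𝔸ˣ)
          (fun z => mlogCfg k η (cubeFam false L a M ρ k) (gaugeAct u⁻¹ (cutFixed L (tLo a ρ) (tHi a M ρ) U₀ k (ctr a M))) z μ) x)
        ≤ 5 * (d : ℝ) * L * B₀ * ((L : ℝ) ^ 3 * α₀ + 6 * d * (L : ℝ) ^ 2 * M * α₀) := by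
  have hL1 : 1 ≤ L := le_trans (by norm_num) hL
  have hd1 : 1 ≤ d := le_trans (by norm_num) hd2
  obtain ⟨cw, hcw, hwin⟩ := prop3_windows hd2 hL hB₀.le
  refine ⟨min cB9 cw, lt_min hcB9 hcw, ?_⟩
  intro η hη k hk a M ρ hρL hρM hM SB9 U₀ hU₀ α₀ hα hα3 hα2 Ω hA hT hsmall hc₀ hc₂ h61 hsmall₁ u hu h129 hLan h162
  have hρ : 1 ≤ ρ := hL1.trans hρL
  have hM1 : 1 ≤ M := hρ.trans hρM
  have hLr : (1 : ℝ) ≤ L := by exact_mod_cast hL1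
  have hdpos : (0 : ℝ) < d := by exact_mod_cast hd1
  have hMpos : (0 : ℝ) < M := by exact_mod_cast hM1
  set α₀' : ℝ := (L : ℝ) ^ 3 * α₀ with hα₀'_def
  set α₁' : ℝ := 6 * d * (L : ℝ) ^ 2 * M * α₀ with hα₁'_def
  set α₂ : ℝ := 5 * (d : ℝ) * L * B₀ * ((L : ℝ) ^ 3 * α₀ + 6 * d * (L : ℝ) ^ 2 * M * α₀) with hα₂_def
  have hα₀' : 0 < α₀' := by positivity
  have hα₁' : 0 < α₁' := by positivity
  have hα₂ : 0 < α₂ := by positivity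
  obtain ⟨hα3', hα4', h16, hd5, hsm, hc₃, hside, h50, hC⟩ :=
    hwin α₀' α₂ hα₀' (hc₀.trans (min_le_right _ _)) hα₂.le (hc₂.trans (min_le_right _ _))
  have hC₂' := hC.trans hC₂
  set U'' := cutFixed L (tLo a ρ) (tHi a M ρ) U₀ k (ctr a M) with hU''
  obtain ⟨hmem, h33, h34, -, -, -⟩ := thm4_hypotheses_one_cutFixed L hL hd1 k U₀ hU₀ hα hα3 hα2 a hρ hρM hM hη hA hT hsmall
  have hone : ∀ x κ, (1 : Site d → Fin d → 𝔸ˣ) x κ ∈ unitaryUnits 𝔸 := fun _ _ => (unitaryUnits 𝔸).one_mem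
  have hui : ∀ x, u⁻¹ x ∈ U1 𝔸 := fun x => unitaryUnits_le_U1 ((unitaryUnits 𝔸).inv_mem (hu x))
  have hU₁u : ∀ x κ, gaugeAct u⁻¹ U'' x κ ∈ unitaryUnits 𝔸 := gaugeAct_mem_of hmem fun x => (unitaryUnits 𝔸).inv_mem (hu x)
  set W : Site d → Fin d → 𝔸ˣ := gaugeAct u⁻¹ U'' with hW_def
  set A : Site d → Fin d → 𝔸 := mlogCfg k η (cubeFam false L a M ρ k) W with hA_def
  -- the canonical exponent: Hermitian, (1.41), `W = e^{iηA}` on the `E j`, `0` off them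
  obtain ⟨hAsa, hrep, hA0⟩ := mlogCfg_spec hη hL1 k (1 : Site d → Fin d → 𝔸ˣ) hU₁u hα₂.le h16 (cubeFam false L a M ρ k)
    (fun j hj y τ hs => ⟨(h162 j hj (y, τ) hs).1, (h162 j hj (y, τ) hs).2.2⟩)
  have h41 : ∀ j, j ≤ k → ∀ (y : Site d) (τ : Fin d), SideTouches (cubeFam false L a M ρ k j) y τ →
      W y τ = cfgExp η A y τ ∧ ‖A y τ‖ ≤ α₂ * ((L : ℝ) ^ j * η)⁻¹ := fun j hj y τ hs =>
    ⟨(hrep j hj y τ hs).2, by rw [hA_def, (hrep j hj y τ hs).1]; exact (h162 j hj (y, τ) hs).2.2⟩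
  have h41' : ∀ j, j ≤ k → ∀ (y : Site d) (τ : Fin d), SideTouches (cubeFam false L a M ρ k j) y τ →
      ‖A y τ‖ ≤ α₂ * ((L : ℝ) ^ j * η)⁻¹ := fun j hj y τ hs => (h41 j hj y τ hs).2
  -- (1.40)₂ for `W·1` by gauge invariance from (1.132), and for `e^{iηA}·1` by locality
  have hW₀ : mulCfg U'' (1 : Site d → Fin d → 𝔸ˣ) = U'' := mul_one _
  have hW₁ : mulCfg W (1 : Site d → Fin d → 𝔸ˣ) = W := mul_one _
  have hPair : InAk L k η α₀' (cubeFam false L a M ρ k) (mulCfg W (1 : Site d → Fin d → 𝔸ˣ)) := by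
    rw [hW₁, hW_def, inAk_gaugeAct_iff L k η _ _ hui]
    rw [hW₀] at h34
    exact h34
  have h40₁ : InAk L k η α₀' (cubeFam false L a M ρ k) (mulCfg (expCfg (iEta η A)) (1 : Site d → Fin d → 𝔸ˣ)) := by
    refine (inAk_congr_of_sideTouches L k η α₀' (V := mulCfg W (1 : Site d → Fin d → 𝔸ˣ)) fun j hj y τ hs => ?_).1 hPair
    show W y τ * (1 : Site d → Fin d → 𝔸ˣ) y τ = expCfg (iEta η A) y τ * (1 : Site d → Fin d → 𝔸ˣ) y τ
    rw [(h41 j hj y τ hs).1, expCfg_iEta_eq_cfgExp]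
  have hAglob : ∀ y τ, ‖A y τ‖ ≤ α₂ * η⁻¹ := by
    intro y τ
    by_cases hmem' : ∃ j, j ≤ k ∧ SideTouches (cubeFam false L a M ρ k j) y τ
    · obtain ⟨j, hj, hs⟩ := hmem'
      have hLj : (1 : ℝ) ≤ (L : ℝ) ^ j := one_le_pow₀ hLr
      calc ‖A y τ‖ ≤ α₂ * ((L : ℝ) ^ j * η)⁻¹ := h41' j hj y τ hs
        _ = α₂ * η⁻¹ * ((L : ℝ) ^ j)⁻¹ := by rw [mul_inv]; ring
        _ ≤ α₂ * η⁻¹ * 1 := by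
            apply mul_le_mul_of_nonneg_left (inv_le_one_of_one_le₀ hLj) (by positivity)
        _ = α₂ * η⁻¹ := mul_one _
    · rw [hA_def, hA0 y τ fun j hj hs => hmem' ⟨j, hj, hs⟩, norm_zero]
      positivity
  have hgrad : ∀ (y : Site d) (κ τ : Fin d), ‖covDerivFwd η (1 : Site d → Fin d → 𝔸ˣ) κ (fun z => A z τ) y‖ ≤ 2 * α₂ * η⁻¹ * η⁻¹ := by
    intro y κ τ
    unfold covDerivFwd
    rw [norm_smul, norm_inv, Real.norm_eq_abs, abs_of_pos hη]
    have h1 : ‖B7Eq78Linearization.conjR ((1 : Site d → Fin d → 𝔸ˣ) y κ) (A (y + e κ) τ) - A y τ‖ ≤ α₂ * η⁻¹ + α₂ * η⁻¹ := by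
      calc ‖B7Eq78Linearization.conjR ((1 : Site d → Fin d → 𝔸ˣ) y κ) (A (y + e κ) τ) - A y τ‖
          ≤ ‖B7Eq78Linearization.conjR ((1 : Site d → Fin d → 𝔸ˣ) y κ) (A (y + e κ) τ)‖ + ‖A y τ‖ := norm_sub_le _ _
        _ ≤ α₂ * η⁻¹ + α₂ * η⁻¹ := by
            rw [B8Ineq132.norm_conjR (unitaryUnits_le_U1 (hone y κ))]
            exact add_le_add (hAglob _ _) (hAglob _ _)
    calc η⁻¹ * ‖B7Eq78Linearization.conjR ((1 : Site d → Fin d → 𝔸ˣ) y κ) (A (y + e κ) τ) - A y τ‖ ≤ η⁻¹ * (α₂ * η⁻¹ + α₂ * η⁻¹) :=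
        mul_le_mul_of_nonneg_left h1 (by positivity)
      _ = 2 * α₂ * η⁻¹ * η⁻¹ := by ring
  have hBg : Bdd L k η (-(2 : ℝ)) (fun j (t : Fin d × Fin d × Site d) => SideTouches (cubeFam false L a M ρ k j) t.2.2 t.2.1)
      (fun t => covDerivFwd η (1 : Site d → Fin d → 𝔸ˣ) t.1 (fun z => A z t.2.1) t.2.2) := by
    have e2 : (-(2 : ℝ)) = -((2 : ℕ) : ℝ) := by norm_num
    rw [e2]
    refine B8ScaledSupNorm.bdd_of_forall (c := 2 * α₂ * ((L : ℝ) ^ k) ^ 2) fun j hj t _ => ?_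
    rw [B8ScaledSupNorm.weight_neg_natCast L η 2 j]
    have hLjk : (L : ℝ) ^ j ≤ (L : ℝ) ^ k := pow_le_pow_right₀ hLr hj
    have hLj0 : (0 : ℝ) ≤ (L : ℝ) ^ j := by positivity
    calc ((L : ℝ) ^ j * η) ^ 2 * ‖covDerivFwd η (1 : Site d → Fin d → 𝔸ˣ) t.1 (fun z => A z t.2.1) t.2.2‖
        ≤ ((L : ℝ) ^ j * η) ^ 2 * (2 * α₂ * η⁻¹ * η⁻¹) := mul_le_mul_of_nonneg_left (hgrad _ _ _) (by positivity)
      _ = 2 * α₂ * ((L : ℝ) ^ j) ^ 2 := by field_simp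
      _ ≤ 2 * α₂ * ((L : ℝ) ^ k) ^ 2 := by gcongr
  set g : ℝ := msup L k η (-(2 : ℝ)) (fun j (t : Fin d × Fin d × Site d) => SideTouches (cubeFam false L a M ρ k j) t.2.2 t.2.1)
      (fun t => covDerivFwd η (1 : Site d → Fin d → 𝔸ˣ) t.1 (fun z => A z t.2.1) t.2.2) with hg_def
  have hg0 : 0 ≤ g := B8ScaledSupNorm.msup_nonneg L k hη.le _ _ _
  have hg : ∀ j, j ≤ k → ∀ (y : Site d) (κ τ : Fin d), SideTouches (cubeFam false L a M ρ k j) y τ →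
      ((L : ℝ) ^ j * η) ^ 2 * ‖covDerivFwd η (1 : Site d → Fin d → 𝔸ˣ) κ (fun z => A z τ) y‖ ≤ g := by
    intro j hj y κ τ hs
    have h := B8ScaledSupNorm.weight_mul_norm_le_msup hBg hj (i := (κ, τ, y)) hs
    have hw : weight L η (-(2 : ℝ)) j = ((L : ℝ) ^ j * η) ^ 2 := by
      have e2 : (-(2 : ℝ)) = -((2 : ℕ) : ℝ) := by norm_num
      rw [e2, B8ScaledSupNorm.weight_neg_natCast L η 2 j]
    rw [hw] at h
    exact h
  -- the in-edge (1.59), five lines, from the FLAT body at the member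
  obtain ⟨h59a, h59g, h59j, h59l, h59h⟩ := SB9 α₀' α₂ hα₀' (hc₀.trans (min_le_left _ _)) hα₂ (hc₂.trans (min_le_left _ _))
    W hU₁u h33 hPair hLan A hAsa h41 hA0
  -- (1.42)₂ at all levels (`c137_cubeMember`) and the boxes of the constraint bonds
  have h42 := c137_cubeMember hd2 hL hk U₀ hU₀ hα hα3 hα2 a hρL hρM hM hη hA hT hsmall hα₂.le hα3' hα4' h16 hsm hc₃ hsmall₁ u hu
    h129 h162
  have hbox : ∀ j, j ≤ k → ∀ c ∈ cubeLamB L a M ρ k k j, ∀ x, InBox (loK L j c.1) (bondHiK L j c.1 c.2) x → x ∈ cubeFam false L a M ρ k j :=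
    fun j hj c hc x hx => hbox_cubeLamB L a M ρ k k le_rfl j hj c hc x hx
  -- PROPOSITION 3 at `k` levels (n05-b): the four members and the Hölder member
  obtain ⟨-, hg', hj, hl⟩ := B8Prop3KLevel.prop3_norms_kLevel hd2 hη hL hone hAsa hα₀' hα₁'.le hα₂.le hg0 hα3' hα4' h16 hd5 hsm hc₃
    hB₀.le hside h50 hC₂' h61 hbox h33 h40₁ h41' hg h42 h59a h59g h59j h59l
  have hh := B8Prop3KLevel.prop3_fifth_kLevel hd2 hη hL hone hAsa hα₀' hα₁'.le hα₂.le hg0 hα3' hα4' h16 hd5 hsm hc₃ hB₀.le hB₀β hside h50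
    hC₂' h61 hbox h33 h40₁ h41' hg h42 h59g h59h
  exact ⟨hg', hh, hj, hl⟩

/-! ## §2 Print's hypotheses and constant -/

/-- **(1.136)₂–₄, THE HÖLDER MEMBER AND THE ALL-LEVELS (1.37) AT THE CONCRETE CUBE MEMBER WITH PRINT'S HYPOTHESES AND CONSTANT, FROM THE
FLAT (1.59) BODY** — `B8Prop6CubeMemberNormsAt.norms136_cubeMember_printed` with the member-level b9 socket replaced by its body at background `1`
(`norms136_cubeMember_flat` + `windows136_of_small` + `c137_cubeMember`): «7dL²Mα₀ ≤ c₁», «L ≤ dM», constant `7dL²B₁Mα₀`, `B₁ = 5dLB₀`.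
[cite: Balaban1985RegularSpaces, Prop. 6 (1.136)–(1.137) p.99, Prop. 3 p.87, (1.134) p.99] -/
theorem norms136_cubeMember_printed_flat (hd2 : 2 ≤ d) {L : ℕ} (hL : 2 ≤ L) {B₀ B₀β C₂ cB9 : ℝ} (hB₀ : 0 < B₀)
    (hB₀β : 0 ≤ B₀β) (hC₂ : 2097152 * ((d : ℝ) + 1) ^ 2 ≤ C₂) (hcB9 : 0 < cB9) (β : ℝ) (len : Site d → ℝ) :
    ∃ c₁ : ℝ, 0 < c₁ ∧ ∀ (η : ℝ), 0 < η → ∀ (k : ℕ), 1 ≤ k → ∀ (a : Site d) (M ρ : ℕ), L ≤ ρ → ρ ≤ M → 11 * (d : ℝ) < M →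
      (L : ℝ) ≤ d * M →
      (∀ α₀' α₂ : ℝ, 0 < α₀' → α₀' ≤ cB9 → 0 < α₂ → α₂ ≤ cB9 →
        ∀ (W : Site d → Fin d → 𝔸ˣ), (∀ x κ, W x κ ∈ unitaryUnits 𝔸) →
        InAk L k η α₀' (cubeFam false L a M ρ k) (1 : Site d → Fin d → 𝔸ˣ) → InAk L k η α₀' (cubeFam false L a M ρ k) (mulCfg W (1 : Site d → Fin d → 𝔸ˣ)) →
        IsLandau138W L k η (cubeFam false L a M ρ k 0) (cubeLamS L a M ρ k k) (1 : Site d → Fin d → 𝔸ˣ) W →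
        ∀ A' : Site d → Fin d → 𝔸, (∀ y τ, IsSelfAdjoint (A' y τ)) →
        (∀ j, j ≤ k → ∀ (y : Site d) (τ : Fin d), SideTouches (cubeFam false L a M ρ k j) y τ →
          W y τ = cfgExp η A' y τ ∧ ‖A' y τ‖ ≤ α₂ * ((L : ℝ) ^ j * η)⁻¹) →
        (∀ (y : Site d) (τ : Fin d), (∀ j, j ≤ k → ¬ SideTouches (cubeFam false L a M ρ k j) y τ) → A' y τ = 0) →
        msup L k η (-(1 : ℝ)) (fun j (b : Site d × Fin d) => SideTouches (cubeFam false L a M ρ k j) b.1 b.2) (fun b => A' b.1 b.2)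
            ≤ B₀ * (bondNorm L k η (-(3 : ℝ)) (cubeFam false L a M ρ k) (fun x μ => Jcur η (1 : Site d → Fin d → 𝔸ˣ) A' μ x)
              + wsup 1 (fun p : {p : ℕ × (Site d × Fin d) // p.1 ≤ k ∧ p.2 ∈ cubeLamB L a M ρ k k p.1} =>
                  linCovIter L (1 : Site d → Fin d → 𝔸ˣ) (iEta η A') p.1.1 p.1.2.1 p.1.2.2)) ∧
          msup L k η (-(2 : ℝ)) (fun j (t : Fin d × Fin d × Site d) => SideTouches (cubeFam false L a M ρ k j) t.2.2 t.2.1)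
              (fun t => covDerivFwd η (1 : Site d → Fin d → 𝔸ˣ) t.1 (fun z => A' z t.2.1) t.2.2)
            ≤ B₀ * (bondNorm L k η (-(3 : ℝ)) (cubeFam false L a M ρ k) (fun x μ => Jcur η (1 : Site d → Fin d → 𝔸ˣ) A' μ x)
              + wsup 1 (fun p : {p : ℕ × (Site d × Fin d) // p.1 ≤ k ∧ p.2 ∈ cubeLamB L a M ρ k k p.1} =>
                  linCovIter L (1 : Site d → Fin d → 𝔸ˣ) (iEta η A') p.1.1 p.1.2.1 p.1.2.2)) ∧
          bondNorm L k η (-(3 : ℝ)) (cubeFam false L a M ρ k) (fun x μ => pdiv η (1 : Site d → Fin d → 𝔸ˣ) (plaqCovDeriv η (1 : Site d → Fin d → 𝔸ˣ) A') μ x)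
            ≤ B₀ * (bondNorm L k η (-(3 : ℝ)) (cubeFam false L a M ρ k) (fun x μ => Jcur η (1 : Site d → Fin d → 𝔸ˣ) A' μ x)
              + wsup 1 (fun p : {p : ℕ × (Site d × Fin d) // p.1 ≤ k ∧ p.2 ∈ cubeLamB L a M ρ k k p.1} =>
                  linCovIter L (1 : Site d → Fin d → 𝔸ˣ) (iEta η A') p.1.1 p.1.2.1 p.1.2.2)) ∧
          bondNorm L k η (-(3 : ℝ)) (cubeFam false L a M ρ k) (fun x μ => covLap η (1 : Site d → Fin d → 𝔸ˣ) (fun z => A' z μ) x)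
            ≤ B₀ * (bondNorm L k η (-(3 : ℝ)) (cubeFam false L a M ρ k) (fun x μ => Jcur η (1 : Site d → Fin d → 𝔸ˣ) A' μ x)
              + wsup 1 (fun p : {p : ℕ × (Site d × Fin d) // p.1 ≤ k ∧ p.2 ∈ cubeLamB L a M ρ k k p.1} =>
                  linCovIter L (1 : Site d → Fin d → 𝔸ˣ) (iEta η A') p.1.1 p.1.2.1 p.1.2.2)) ∧
          msup L k η (-(2 + β)) (fun j (q : Fin d × Fin d × (Site d × Site d)) => q.2.2 ∈ AdmPair η len ∧ q.2.2.1 ∈ cubeFam false L a M ρ k j)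
              (fun q => hquot η β len (1 : Site d → Fin d → 𝔸ˣ) (covDerivFwd η (1 : Site d → Fin d → 𝔸ˣ) q.1 (fun z => A' z q.2.1)) q.2.2)
            ≤ B₀β * (bondNorm L k η (-(3 : ℝ)) (cubeFam false L a M ρ k) (fun x μ => Jcur η (1 : Site d → Fin d → 𝔸ˣ) A' μ x)
              + wsup 1 (fun p : {p : ℕ × (Site d × Fin d) // p.1 ≤ k ∧ p.2 ∈ cubeLamB L a M ρ k k p.1} =>
                  linCovIter L (1 : Site d → Fin d → 𝔸ˣ) (iEta η A') p.1.1 p.1.2.1 p.1.2.2))) →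
      ∀ (U₀ : Site d → Fin d → 𝔸ˣ), (∀ x κ, U₀ x κ ∈ unitaryUnits 𝔸) → ∀ (α₀ : ℝ), 0 < α₀ →
      ∀ (Ω : ℕ → Set (Site d)), InAk L k η α₀ Ω U₀ → tcube L a M ρ k ⊆ Ω (k - 1) →
      7 * d * (L : ℝ) ^ 2 * M * α₀ ≤ c₁ →
      ∀ (u : Site d → 𝔸ˣ), (∀ x, u x ∈ unitaryUnits 𝔸) →
      Restr129 L k (cubeLamS L a M ρ k k) (1 : Site d → Fin d → 𝔸ˣ) u →
      IsLandau138W L k η (cubeFam false L a M ρ k 0) (cubeLamS L a M ρ k k) (1 : Site d → Fin d → 𝔸ˣ)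
        (gaugeAct u⁻¹ (cutFixed L (tLo a ρ) (tHi a M ρ) U₀ k (ctr a M))) →
      (∀ j, j ≤ k → ∀ b ∈ {b : Site d × Fin d | SideTouches (cubeFam false L a M ρ k j) b.1 b.2},
        gaugeAct u⁻¹ (cutFixed L (tLo a ρ) (tHi a M ρ) U₀ k (ctr a M)) b.1 b.2 =
            cfgExp η (logCfg η (gaugeAct u⁻¹ (cutFixed L (tLo a ρ) (tHi a M ρ) U₀ k (ctr a M)))) b.1 b.2 ∧
          IsSelfAdjoint (logCfg η (gaugeAct u⁻¹ (cutFixed L (tLo a ρ) (tHi a M ρ) U₀ k (ctr a M))) b.1 b.2) ∧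
          ‖logCfg η (gaugeAct u⁻¹ (cutFixed L (tLo a ρ) (tHi a M ρ) U₀ k (ctr a M))) b.1 b.2‖ ≤
            (5 * (d : ℝ) * L * B₀ * ((L : ℝ) ^ 3 * α₀ + 6 * d * (L : ℝ) ^ 2 * M * α₀)) * ((L : ℝ) ^ j * η)⁻¹) →
      (∀ j, j ≤ k → ∀ c ∈ cubeLamB L a M ρ k k j,
        ‖logCovIter L (1 : Site d → Fin d → 𝔸ˣ)
            (iEta η (mlogCfg k η (cubeFam false L a M ρ k) (gaugeAct u⁻¹ (cutFixed L (tLo a ρ) (tHi a M ρ) U₀ k (ctr a M)))))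
            j c.1 c.2‖ < 2 * d * L * (6 * d * (L : ℝ) ^ 2 * M * α₀)) ∧
      msup L k η (-(2 : ℝ)) (fun j (t : Fin d × Fin d × Site d) => SideTouches (cubeFam false L a M ρ k j) t.2.2 t.2.1)
          (fun t => covDerivFwd η (1 : Site d → Fin d → 𝔸ˣ) t.1 (fun z => mlogCfg k η (cubeFam false L a M ρ k)
            (gaugeAct u⁻¹ (cutFixed L (tLo a ρ) (tHi a M ρ) U₀ k (ctr a M))) z t.2.1) t.2.2)
        ≤ 7 * d * (L : ℝ) ^ 2 * (5 * (d : ℝ) * L * B₀) * M * α₀ ∧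
      msup L k η (-(2 + β)) (fun j (q : Fin d × Fin d × (Site d × Site d)) => q.2.2 ∈ AdmPair η len ∧ q.2.2.1 ∈ cubeFam false L a M ρ k j)
          (fun q => hquot η β len (1 : Site d → Fin d → 𝔸ˣ) (covDerivFwd η (1 : Site d → Fin d → 𝔸ˣ) q.1
            (fun z => mlogCfg k η (cubeFam false L a M ρ k) (gaugeAct u⁻¹ (cutFixed L (tLo a ρ) (tHi a M ρ) U₀ k (ctr a M))) z q.2.1))
            q.2.2)
        ≤ 7 * d * (L : ℝ) ^ 2 * (5 * (d : ℝ) * L * B₀β) * M * α₀ ∧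
      bondNorm L k η (-(3 : ℝ)) (cubeFam false L a M ρ k) (fun x μ => pdiv η (1 : Site d → Fin d → 𝔸ˣ)
          (plaqCovDeriv η (1 : Site d → Fin d → 𝔸ˣ) (mlogCfg k η (cubeFam false L a M ρ k)
            (gaugeAct u⁻¹ (cutFixed L (tLo a ρ) (tHi a M ρ) U₀ k (ctr a M))))) μ x)
        ≤ 7 * d * (L : ℝ) ^ 2 * (5 * (d : ℝ) * L * B₀) * M * α₀ ∧
      bondNorm L k η (-(3 : ℝ)) (cubeFam false L a M ρ k) (fun x μ => covLap η (1 : Site d → Fin d → 𝔸ˣ)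
          (fun z => mlogCfg k η (cubeFam false L a M ρ k) (gaugeAct u⁻¹ (cutFixed L (tLo a ρ) (tHi a M ρ) U₀ k (ctr a M))) z μ) x)
        ≤ 7 * d * (L : ℝ) ^ 2 * (5 * (d : ℝ) * L * B₀) * M * α₀ := by
  have hL1 : 1 ≤ L := le_trans (by norm_num) hL
  have hd1 : 1 ≤ d := le_trans (by norm_num) hd2
  have hLpos : (0 : ℝ) < L := by exact_mod_cast hL1
  have hdpos : (0 : ℝ) < d := by exact_mod_cast hd1
  have hC₂0 : 0 ≤ C₂ := le_trans (by positivity) hC₂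
  obtain ⟨c, hc, H⟩ := norms136_cubeMember_flat (𝔸 := 𝔸) hd2 hL hB₀ hB₀β hC₂ hcB9 β len
  obtain ⟨c₁, hc₁, W⟩ := windows136_of_small hd2 hL hB₀ hC₂0 hc
  refine ⟨c₁, hc₁, ?_⟩
  intro η hη k hk a M ρ hρL hρM hM hLdM SB9 U₀ hU₀ α₀ hα Ω hA hT hs u hu h129 hLan h162
  have hρ : 1 ≤ ρ := hL1.trans hρL
  have hM1 : 1 ≤ M := hρ.trans hρM
  obtain ⟨⟨hα3, hα2, hsmall⟩, ⟨hc₀, -, hc₂⟩, h61, ⟨hα3', hα4', h16, hsm, hc₃, h8⟩, -⟩ := W M ρ hM1 hρM hM hLdM α₀ hα hs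
  have h137 := c137_cubeMember hd2 hL hk U₀ hU₀ hα hα3 hα2 a hρL hρM hM hη hA hT hsmall (by positivity) hα3' hα4' h16 hsm hc₃ h8 u hu
    h129 h162
  obtain ⟨hg, hh, hj, hl⟩ := H η hη k hk a M ρ hρL hρM hM SB9 U₀ hU₀ α₀ hα hα3 hα2 Ω hA hT hsmall hc₀ hc₂ h61 h8 u hu h129 hLan h162
  have hB : 0 ≤ 5 * (d : ℝ) * L * B₀ := by positivity
  have hBβ : 0 ≤ 5 * (d : ℝ) * L * B₀β := by positivity
  have e136 := const_136 hLpos hα hB hLdM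
  have e136β := const_136 hLpos hα hBβ hLdM
  exact ⟨h137, hg.trans e136, hh.trans e136β, hj.trans e136, hl.trans e136⟩

#print axioms norms136_cubeMember_flat
#print axioms norms136_cubeMember_printed_flat

end Literature.MathematicalPhysics.QuantumFieldTheory.Balaban1983to89.B8Prop6CubeMemberNormsFlat

end
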